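import Literature.Analysis.SegalBargmann.HermiteLadder
import Mathlib.Analysis.Distribution.SchwartzSpace.Fourier
import Mathlib.Analysis.SpecialFunctions.Gaussian.FourierTransform
import HarnessLib

/-!
# The Hermite functions diagonalise the Fourier transform on `𝓢(ℝ^σ, ℂ)` (Folland 1989, §1.7)

Topic `Analysis/SegalBargmann`; namespace `Literature.Analysis.SegalBargmann`.  Continuation of
`Literature.Analysis.SegalBargmann.HermiteLadder`.  With Mathlib's Fourier transform `𝓕` on Schwartz space
(`𝓕 f (ξ) = ∫ e^{−2πi⟪x,ξ⟫} f(x) dx`, `SchwartzMap.fourierTransformCLM`) and Folland's operators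
`X_j = x_j`, `D_j = (2πi)⁻¹∂_j`, `Z_j = X_j + iD_j`, `Z_j^* = X_j − iD_j` realised on `𝓢(ℝ^σ, ℂ)` in
`HermiteOscillator` / `HermiteLadder`:

* §1 `𝓕 ∘ X_j = −D_j ∘ 𝓕`, `𝓕 ∘ D_j = X_j ∘ 𝓕` as OPERATOR identities on all of `𝓢(ℝ^σ, ℂ)` (Mathlib's
  `SchwartzMap.lineDerivOp_fourier_eq` / `fourier_lineDerivOp_eq` in Folland's letters); hence
  **`𝓕 ∘ Z_j^* = −i Z_j^* ∘ 𝓕`, `𝓕 ∘ Z_j = i Z_j ∘ 𝓕`**, and the Fourier transform COMMUTES with every Hermite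
  operator `2π(D_j² + X_j²)` and with the number operator (`fourier_hermiteOpCLM`, `fourier_numberOpCLM`).
* §2 the Gaussian `h_0 = e^{−π|x|²}` is its own Fourier transform (Mathlib `fourier_gaussian_innerProductSpace` at
  `b = π`), hence so is the vacuum `hermiteSchwartz (vac σ)`.
* §3 **`𝓕 h_α = (−i)^{|α|} h_α`** for every multi-index `α` (`fourier_hermiteSchwartz_herm`; induction on `|α|`
  along the creation ladder of `HermiteLadder`), and for every Fock polynomial `F` homogeneous of degree `d`,
  `𝓕 (B⁻¹F) = (−i)^d · B⁻¹F` (`fourier_hermiteSchwartz_binv_of_isHomogeneous`).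

Classical statement: N. Wiener (1933) / Folland 1989 §1.7 (the Hermite functions are an eigenbasis of the
Fourier transform with eigenvalues `(−i)^{|α|}`; equivalently `𝓕 = e^{−iπN/2}` is the time-`π/2` oscillator
propagator, Folland Prop. (4.49)/§4.4 — the Weyl element of the metaplectic representation).  Everything here is
proved from Mathlib and the imported tree files; no cited fact is used as a hypothesis.

Motivation (not used in any statement): in the Schrödinger model of the oscillator (Weil) representation the Weyl
element acts by the Fourier transform; §3 says it acts on the inverse-Bargmann image of the degree-`d` Fock
polynomials by the scalar `(−i)^d` — the `K`-finite-level object match for the Weyl element.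

## References

* G. B. Folland, *Harmonic Analysis in Phase Space*, Annals of Mathematics Studies 122, Princeton UP (1989): §1.7
  (Hermite functions; `D_j`, `X_j`, `Z_j`, `Z_j^*`), Thm (1.83), Prop. (4.49) / §4.4.  [cite: Folland1989, §1.7]

## Provenance

Written for the tree under the LEAN-IN-TREE rule (2026-08-18) by the pub-hodgecm formalisation cell (model-construction
sub-cell, seat mc-binder-2).
-/

set_option autoImplicit false

noncomputable section

open MvPolynomial Complex SchwartzMap MeasureTheory FourierTransform
open scoped BigOperators Real LineDeriv FourierTransform RealInnerProductSpace

namespace Literature.Analysis.SegalBargmann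

variable {σ : Type*} [Fintype σ] [DecidableEq σ]

/-! ## §1  The Fourier transform in Folland's letters: `𝓕X_j = −D_j𝓕`, `𝓕D_j = X_j𝓕` -/

section Letters

/-- `⟪x, e_j⟫ = x_j` on `EuclideanSpace ℝ σ`. [folklore] -/
theorem inner_euclideanSingle_one_right (x : EuclideanSpace ℝ σ) (j : σ) :
    ⟪x, EuclideanSpace.single j (1 : ℝ)⟫ = x j := by
  rw [EuclideanSpace.inner_single_right, one_mul]
  rfl

/-- Mathlib's real multiplier by `⟪·, e_j⟫` (as used in `SchwartzMap.lineDerivOp_fourier_eq`) IS the coordinate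
multiplication operator `coordMulCLM j` of `HermiteOscillator`. [folklore] -/
theorem smulLeftCLM_inner_single (j : σ) (f : 𝓢(EuclideanSpace ℝ σ, ℂ)) :
    SchwartzMap.smulLeftCLM ℂ (fun x : EuclideanSpace ℝ σ => ⟪x, EuclideanSpace.single j (1 : ℝ)⟫) f =
      coordMulCLM j f := by
  have hg : (fun x : EuclideanSpace ℝ σ => ⟪x, EuclideanSpace.single j (1 : ℝ)⟫).HasTemperateGrowth :=
    ((innerSL ℝ).flip (EuclideanSpace.single j (1 : ℝ))).hasTemperateGrowth
  ext x
  rw [SchwartzMap.smulLeftCLM_apply_apply hg, coordMulCLM_apply, inner_euclideanSingle_one_right,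
    Complex.real_smul]

variable (j : σ) (f : 𝓢(EuclideanSpace ℝ σ, ℂ))

/-- **`𝓕 (x_j f) = −D_j (𝓕 f)`**, `D_j = (2πi)⁻¹∂_j` (Folland §1.7; Mathlib `lineDerivOp_fourier_eq`). [cite: Folland1989, §1.7] -/
theorem fourier_coordMulCLM : 𝓕 (coordMulCLM j f) = -opDCLM j (𝓕 f) := by
  have h : opDCLM j (𝓕 f) = -𝓕 (coordMulCLM j f) := by
    rw [opDCLM_eq_smul, SchwartzMap.lineDerivOp_fourier_eq, smulLeftCLM_inner_single, FourierSMul.fourier_smul, smul_smul,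
      show (2 * π * I : ℂ)⁻¹ * -(2 * π * I) = -1 by rw [mul_neg, inv_mul_cancel₀ two_pi_I_ne_zero],
      neg_one_smul]
  rw [h, neg_neg]

/-- **`𝓕 (D_j f) = x_j (𝓕 f)`** (Folland §1.7; Mathlib `fourier_lineDerivOp_eq`). [cite: Folland1989, §1.7] -/
theorem fourier_opDCLM : 𝓕 (opDCLM j f) = coordMulCLM j (𝓕 f) := by
  rw [opDCLM_eq_smul, FourierSMul.fourier_smul, SchwartzMap.fourier_lineDerivOp_eq, smulLeftCLM_inner_single, smul_smul,
    inv_mul_cancel₀ two_pi_I_ne_zero, one_smul]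

/-- **`𝓕 Z_j^* = −i Z_j^* 𝓕`**: the Fourier transform intertwines the creation operator with `−i` times itself,
on ALL of `𝓢(ℝ^σ, ℂ)`. [cite: Folland1989, §1.7] -/
theorem fourier_zsCLM : 𝓕 (zsCLM j f) = (-I) • zsCLM j (𝓕 f) := by
  have h1 : zsCLM j f = coordMulCLM j f - I • opDCLM j f := rfl
  have h2 : zsCLM j (𝓕 f) = coordMulCLM j (𝓕 f) - I • opDCLM j (𝓕 f) := rfl
  rw [h1, h2, sub_eq_add_neg, FourierAdd.fourier_add, FourierTransform.fourier_neg, FourierSMul.fourier_smul, fourier_coordMulCLM, fourier_opDCLM,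
    smul_sub, smul_smul, show (-I) * I = (1 : ℂ) by rw [neg_mul, I_mul_I, neg_neg], one_smul, neg_smul]
  abel

/-- **`𝓕 Z_j = i Z_j 𝓕`**: the Fourier transform intertwines the annihilation operator with `i` times itself.
[cite: Folland1989, §1.7] -/
theorem fourier_zCLM : 𝓕 (zCLM j f) = I • zCLM j (𝓕 f) := by
  have h1 : zCLM j f = coordMulCLM j f + I • opDCLM j f := rfl
  have h2 : zCLM j (𝓕 f) = coordMulCLM j (𝓕 f) + I • opDCLM j (𝓕 f) := rfl
  rw [h1, h2, FourierAdd.fourier_add, FourierSMul.fourier_smul, fourier_coordMulCLM, fourier_opDCLM, smul_add, smul_smul, I_mul_I,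
    neg_one_smul]
  abel

/-- **The Fourier transform commutes with the Hermite operator** `2π(D_j² + X_j²)` on `𝓢(ℝ^σ, ℂ)`
(`𝓕X_j² = D_j²𝓕`, `𝓕D_j² = X_j²𝓕`). [cite: Folland1989, §1.7] -/
theorem fourier_hermiteOpCLM : 𝓕 (hermiteOpCLM j f) = hermiteOpCLM j (𝓕 f) := by
  have h1 : hermiteOpCLM j f = (2 * π : ℂ) • (opDCLM j (opDCLM j f) + coordMulCLM j (coordMulCLM j f)) := rfl
  have h2 : hermiteOpCLM j (𝓕 f) =
      (2 * π : ℂ) • (opDCLM j (opDCLM j (𝓕 f)) + coordMulCLM j (coordMulCLM j (𝓕 f))) := rfl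
  rw [h1, h2, FourierSMul.fourier_smul, FourierAdd.fourier_add, fourier_opDCLM, fourier_opDCLM, fourier_coordMulCLM, fourier_coordMulCLM,
    map_neg, neg_neg, add_comm]

/-- **The Fourier transform commutes with the number operator** `N = ½Σ_j(2π(D_j²+X_j²) − 1)`. [cite: Folland1989, §1.7] -/
theorem fourier_numberOpCLM : 𝓕 (numberOpCLM f) = numberOpCLM (𝓕 f) := by
  rw [numberOpCLM, smul_apply, smul_apply, FourierSMul.fourier_smul, sum_apply, sum_apply, FourierTransform.fourier_sum]
  congr 1
  refine Finset.sum_congr rfl fun j _ => ?_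
  rw [sub_apply, sub_apply, sub_eq_add_neg, FourierAdd.fourier_add, FourierTransform.fourier_neg, fourier_hermiteOpCLM,
    ContinuousLinearMap.id_apply, ContinuousLinearMap.id_apply, sub_eq_add_neg]

end Letters

/-! ## §2  The Gaussian and the vacuum are self-dual -/

section Gaussian

open Literature.Analysis.FunctionSpaces

omit [DecidableEq σ] in
/-- **`𝓕 e^{−π|x|²} = e^{−π|ξ|²}`** in `𝓢(ℝ^σ, ℂ)` (Mathlib `fourier_gaussian_innerProductSpace` at `b = π`, packaged
on the tree's `gaussianSchwartz`). [folklore] -/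
theorem fourier_gaussianSchwartz_pi :
    𝓕 (gaussianSchwartz (EuclideanSpace ℝ σ) π) = gaussianSchwartz (EuclideanSpace ℝ σ) π := by
  ext ξ
  rw [SchwartzMap.fourier_coe, gaussianSchwartz_apply Real.pi_pos, coe_gaussianSchwartz Real.pi_pos]
  have hfun : (fun x : EuclideanSpace ℝ σ => ((Real.exp (-π * ‖x‖ ^ 2) : ℝ) : ℂ)) =
      fun v : EuclideanSpace ℝ σ => cexp (-(π : ℂ) * ‖v‖ ^ 2) := by
    funext v
    rw [Complex.ofReal_exp]
    push_cast
    rfl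
  have hb : 0 < ((π : ℂ)).re := by rw [Complex.ofReal_re]; exact Real.pi_pos
  rw [hfun, fourier_gaussian_innerProductSpace hb ξ, div_self (Complex.ofReal_ne_zero.mpr Real.pi_ne_zero),
    Complex.one_cpow, one_mul, Complex.ofReal_exp]
  congr 1
  push_cast
  field_simp

omit [DecidableEq σ] in
/-- The vacuum of the Hermite span is a multiple of the Gaussian: `hermiteSchwartz (vac σ) = vacCoef σ • e^{−π|x|²}`.
[folklore] -/
theorem hermiteSchwartz_vac :
    hermiteSchwartz (vac σ) = (vacCoef σ : ℂ) • gaussianSchwartz (EuclideanSpace ℝ σ) π := by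
  ext x
  rw [hermiteSchwartz_apply, smul_apply, smul_eq_mul, ← gauss_eq_gaussianSchwartz]
  simp [hermiteFun, vac]

omit [DecidableEq σ] in
/-- **The vacuum is its own Fourier transform**: `𝓕 h_0 = h_0`. [cite: Folland1989, §1.7] -/
theorem fourier_hermiteSchwartz_vac : 𝓕 (hermiteSchwartz (vac σ)) = hermiteSchwartz (vac σ) := by
  rw [hermiteSchwartz_vac, FourierSMul.fourier_smul, fourier_gaussianSchwartz_pi]

end Gaussian

/-! ## §3  `𝓕 h_α = (−i)^{|α|} h_α` -/

section Eigen

omit [DecidableEq σ] in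
/-- `hermiteSchwartz` of a finite sum of symbols (linearity, `hermiteSchwartzₗ`). [folklore] -/
theorem hermiteSchwartz_sum {ι : Type*} (s : Finset ι) (q : ι → MvPolynomial σ ℂ) :
    hermiteSchwartz (∑ i ∈ s, q i) = ∑ i ∈ s, hermiteSchwartz (q i) :=
  map_sum (hermiteSchwartzₗ (σ := σ)) q s

/-- **The Hermite functions are eigenfunctions of the Fourier transform**: `𝓕 h_α = (−i)^{|α|} · h_α` for every
multi-index `α ∈ ℕ^σ`, `|α| = α.degree` (N. Wiener 1933; Folland 1989 §1.7 / Prop. (4.49): `𝓕` is the time-`π/2`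
oscillator propagator).  Proof: induction on `|α|` along the creation ladder `h_{β+1_j} = c⁻¹ Z_j^* h_β`
(`zsCLM_herm`) using `𝓕 Z_j^* = −i Z_j^* 𝓕` and `𝓕 h_0 = h_0`. [cite: Folland1989, §1.7] -/
theorem fourier_hermiteSchwartz_herm (α : σ →₀ ℕ) :
    𝓕 (hermiteSchwartz (herm α)) = (-I) ^ α.degree • hermiteSchwartz (herm α) := by
  suffices h : ∀ (n : ℕ) (β : σ →₀ ℕ), β.degree = n →
      𝓕 (hermiteSchwartz (herm β)) = (-I) ^ n • hermiteSchwartz (herm β) from h _ α rfl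
  intro n
  induction n with
  | zero =>
      intro β hβ
      rw [Finsupp.degree_eq_zero_iff] at hβ
      subst hβ
      rw [pow_zero, one_smul, herm_zero, fourier_hermiteSchwartz_vac]
  | succ n ih =>
      intro β hβ
      have hne : β ≠ 0 := by
        intro h0
        rw [h0, map_zero] at hβ
        exact Nat.succ_ne_zero n hβ.symm
      obtain ⟨j, hj⟩ : ∃ j, β j ≠ 0 := by
        by_contra hall
        push Not at hall
        exact hne (Finsupp.ext hall)
      have hle : Finsupp.single j 1 ≤ β := Finsupp.single_le_iff.mpr (Nat.one_le_iff_ne_zero.mpr hj)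
      set γ : σ →₀ ℕ := β - Finsupp.single j 1 with hγ_def
      have hγβ : γ + Finsupp.single j 1 = β := tsub_add_cancel_of_le hle
      have hγdeg : γ.degree = n := by
        have hsum := congrArg Finsupp.degree hγβ
        rw [map_add, Finsupp.degree_single, hβ] at hsum
        omega
      -- the creation ladder: `Z_j^* h_γ = c • h_β`, `c = √((γ_j + 1)/π) ≠ 0`
      have hlad := zsCLM_herm j γ
      rw [hγβ] at hlad
      have hcpos : 0 < Real.sqrt (((γ j : ℝ) + 1) / π) := Real.sqrt_pos.mpr (by positivity)
      have hc : (Real.sqrt (((γ j : ℝ) + 1) / π) : ℂ) ≠ 0 := Complex.ofReal_ne_zero.mpr hcpos.ne'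
      have hexpr : hermiteSchwartz (herm β) =
          (Real.sqrt (((γ j : ℝ) + 1) / π) : ℂ)⁻¹ • zsCLM j (hermiteSchwartz (herm γ)) := by
        rw [hlad, smul_smul, inv_mul_cancel₀ hc, one_smul]
      rw [hexpr, FourierSMul.fourier_smul, fourier_zsCLM, ih γ hγdeg, map_smul, smul_smul, smul_smul, smul_smul, pow_succ]
      congr 1
      ring

/-- The same through the degree of a monomial: `𝓕 (B⁻¹ z^α) = (−i)^{|α|} B⁻¹ z^α`. [cite: Folland1989, §1.7] -/
theorem fourier_hermiteSchwartz_binv_monomial (α : σ →₀ ℕ) (c : ℂ) :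
    𝓕 (hermiteSchwartz (binv (monomial α c))) = (-I) ^ α.degree • hermiteSchwartz (binv (monomial α c)) := by
  have hmono : binv (monomial α c) = (c * ((hcoef α : ℂ))⁻¹) • herm α := by
    have hh : (hcoef α : ℂ) ≠ 0 := Complex.ofReal_ne_zero.mpr (hcoef_pos α).ne'
    rw [herm_eq, smul_smul, mul_assoc, inv_mul_cancel₀ hh, mul_one, ← map_smul, smul_monomial, smul_eq_mul,
      mul_one]
  rw [hmono, hermiteSchwartz_smul, FourierSMul.fourier_smul, fourier_hermiteSchwartz_herm, smul_comm]

/-- **The Weyl element on the degree-`d` Fock space**: for a Fock polynomial `F` homogeneous of degree `d`,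
`𝓕 (B⁻¹F) = (−i)^d · B⁻¹F`, `B⁻¹F = hermiteSchwartz (binv F)` (Folland §1.7 with Prop. (4.49)/§4.4: in the
Schrödinger model the Weyl element of the oscillator representation is the Fourier transform, and it acts on the
image of `𝒫_d` by the scalar `(−i)^d`). [cite: Folland1989, §1.7] -/
theorem fourier_hermiteSchwartz_binv_of_isHomogeneous {F : MvPolynomial σ ℂ} {d : ℕ} (hF : F.IsHomogeneous d) :
    𝓕 (hermiteSchwartz (binv F)) = (-I) ^ d • hermiteSchwartz (binv F) := by
  have hdeg : ∀ α ∈ F.support, α.degree = d := fun α hα => by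
    rw [Finsupp.degree_eq_weight_one]
    exact hF (mem_support_iff.mp hα)
  conv_lhs => rw [F.as_sum]
  conv_rhs => rw [F.as_sum]
  rw [map_sum, hermiteSchwartz_sum, FourierTransform.fourier_sum, Finset.smul_sum]
  refine Finset.sum_congr rfl fun α hα => ?_
  show 𝓕 (hermiteSchwartz (binv (monomial α (coeff α F)))) = (-I) ^ d • hermiteSchwartz (binv (monomial α (coeff α F)))
  rw [fourier_hermiteSchwartz_binv_monomial, hdeg α hα]

end Eigen

end Literature.Analysis.SegalBargmann

end
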